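import Mathlib.Probability.Martingale.Centering
import Literature.Analysis.FluidPDE.HardSphereCollisionRecord
import Literature.Analysis.FluidPDE.HardSphereFlowJointMeasurable
import Literature.Analysis.FluidPDE.HardSphereFlowMeasurable
import Literature.MathematicalPhysics.KineticTheory.HardSphereTwoTimePressure
import Literature.MathematicalPhysics.KineticTheory.HardSphereEulerProofs
import HarnessLib

/-!
# Objects of the crux line `dynkin-azuma-collision-innovations` (crux `KineticFluxLdDecay`,
# stmt-AtomisticToContinuum-10967; routes AntiMazurCoboundaries r4 / FluxGibbsianityLdDrude r2)

Objects module (definitions + the registered bookkeeping stub `stub_skeletonBookkeeping`, S0): the objects of the registered skeleton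
`Cruxes/KineticFluxLdDecay/Lines/dynkin-azuma-collision-innovations.lean` §0–§4, moved verbatim into an
importable `Theorems` module so that the stub helper files of the line (one per registered stub,
`--supports stmt-AtomisticToContinuum-10967`) and the eventual closing file can share ONE copy of them:

* §0 frame: `Flow`, `Phase`, `gibbs` (the homogeneous Gibbs law `G_N`), `ell`, `window`, `sv`, the crux
  functional `obsA`, (the orthogonality clause is kept unfolded in the stubs);
* §1 the per-particle clamp: `collCount`, `busy`, `busyCount`, `stopTime`, the clamped functional `obsB`;
* §2 relevant collisions: `counted`, `relTimes`, `relCount`, `relTime`, `horizon`;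
* §3 discrete marks and binned payloads: `bin`, `binVal`, `binVec`, `clip`, `preVelOf`, `ParticleMark`,
  `Mark`, `particleMarkAt`, `markAt`, `payloadAt`, `payloadCap`, `payloadY`, `procX`, `record`,
  `causalSigma`;
* §4 Doob decomposition: `innov` (martingale part), `comp` (predictable part), `defect` (`comp - h·obsB`).

All orbit functionals are guarded by the good set `Φ.good` (junk value `0` / `h` off it, documented at
each definition). The flags `busy`, `counted` are Boolean-valued (decided classically): data, not propositions. Source of the construction: the line card `Lines/dynkin-azuma-collision-innovations.md`
(Chapman–Enskog corrector + Doob decomposition along a coarse collision filtration; Kipnis–Landim 1999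
App. 1 §5–6 for the Dynkin-martingale paradigm, Azuma 1967 / Hoeffding 1963).
-/

noncomputable section

open MeasureTheory ProbabilityTheory Set Filter
open scoped ENNReal BigOperators
open Literature.Analysis.FluidPDE Literature.MathematicalPhysics.KineticTheory

namespace Summit.AtomisticToContinuum.HydrodynamicLimit.Theorems.DynkinAzuma

/-! ## § 0 Frame (the crux's objects, named) -/

/-- The hard-sphere flows of the crux: `N + 1` spheres of diameter `σ (N+1)^{-1/3}` on `𝕋³`. -/
abbrev Flow (σ : ℝ) (N : ℕ) : Type :=
  HardSphereFlow (Torus.geometry (Fin 3)) (hsDiameter σ N) (N + 1)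

/-- Phase space of `N + 1` spheres on `𝕋³`. -/
abbrev Phase (N : ℕ) : Type := Config (N + 1) (Fin 3) T3

/-- The homogeneous Gibbs law `G_N` of the crux. -/
abbrev gibbs (σ a θ : ℝ) (u₀ : V3) (N : ℕ) (Φ : Flow σ N) : Measure (Phase N) :=
  localGibbsLaw σ (fun _ => a) (fun _ => u₀) (fun _ => θ) N Φ

/-- The macroscopic interparticle scale `ℓ_N = (N+1)^{-1/3}`. -/
def ell (N : ℕ) : ℝ := ((N + 1 : ℕ) : ℝ) ^ (-(1 / 3 : ℝ))

/-- The kinetic window `h = τ ℓ_N`. -/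
def window (τ : ℝ) (N : ℕ) : ℝ := τ * ((N + 1 : ℕ) : ℝ) ^ (-(1 / 3 : ℝ))

/-- Scaled peculiar velocity `w = (v - u₀)/√θ` (standard Gaussian under `G_N`). -/
def sv (θ : ℝ) (u₀ : V3) (v : V3) : V3 := (Real.sqrt θ)⁻¹ • (v - u₀)

/-- The crux's window functional `A(z) = h⁻¹ ∫₀ʰ F(Φ_s z) ds`, `F(z) = ∑ᵢ φ(xᵢ) g(wᵢ)` (literally the
integrand of `KineticFluxLdDecay`). -/
def obsA (θ : ℝ) (u₀ : V3) (φ : T3 → ℝ) (g : V3 → ℝ) (τ : ℝ) {σ : ℝ} {N : ℕ} (Φ : Flow σ N)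
    (z : Phase N) : ℝ :=
  (window τ N)⁻¹ * ∫ s in (0 : ℝ)..window τ N,
    ∑ i, φ (Φ.flow s z i).1 * g (sv θ u₀ (Φ.flow s z i).2)

/-! ## § 1 The per-particle clamp at the `K`-th collision of the window -/

/-- The number of collisions of particle `i` in the window `(0, h]` along the orbit of `z`
(`Set.ncard`; finite on good orbits, junk `0` otherwise). -/
def collCount {σ : ℝ} {N : ℕ} (Φ : Flow σ N) (h : ℝ) (i : Fin (N + 1)) (z : Phase N) : ℕ :=
  (collisionTimesOf (Torus.geometry (Fin 3)) (hsDiameter σ N) (fun s => Φ.flow s z) i ∩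
    Set.Ioc 0 h).ncard

open scoped Classical in
/-- Particle `i` is **busy** in the window `(0, h]`: it has at least `K + 1` collisions there
(guarded by the good set, so that every orbit functional below is junk-free off `Φ.good`).
Boolean-valued (decided classically), so that it is data, not a proposition. -/
def busy {σ : ℝ} {N : ℕ} (Φ : Flow σ N) (K : ℕ) (h : ℝ) (i : Fin (N + 1)) (z : Phase N) : Bool :=
  decide (z ∈ Φ.good ∧ K + 1 ≤ collCount Φ h i z)

/-- The number of busy particles. -/
def busyCount {σ : ℝ} {N : ℕ} (Φ : Flow σ N) (K : ℕ) (h : ℝ) (z : Phase N) : ℕ :=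
  (Finset.univ.filter fun i => busy Φ K h i z = true).card

/-- The **stopping time** of particle `i`: the time of its collision of index `K` (0-based, after
time `0`; `HardSphereFlow.nthCollisionTimeOf`) if `i` is busy — clamped into `[0, h]`, which is
inactive on good orbits — else `h`. Particle `i`'s collisions at times `≤ stopTime` (its first
`K + 1` in the window) are the COUNTED ones. -/
def stopTime {σ : ℝ} {N : ℕ} (Φ : Flow σ N) (K : ℕ) (h : ℝ) (i : Fin (N + 1)) (z : Phase N) : ℝ :=
  if busy Φ K h i z = true then max 0 (min h (Φ.nthCollisionTimeOf i K z)) else h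

/-- The **clamped window functional** `B(z) = h⁻¹ ∑ᵢ ∫₀^{Tᵢ} φ(xᵢ(s)) g(wᵢ(s)) ds`: each particle's
contribution stopped at its `K`-th collision. -/
def obsB (θ : ℝ) (u₀ : V3) (φ : T3 → ℝ) (g : V3 → ℝ) (τ : ℝ) (K : ℕ) {σ : ℝ} {N : ℕ} (Φ : Flow σ N)
    (z : Phase N) : ℝ :=
  (window τ N)⁻¹ * ∑ i, ∫ s in (0 : ℝ)..stopTime Φ K (window τ N) i z,
    φ (Φ.flow s z i).1 * g (sv θ u₀ (Φ.flow s z i).2)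

/-! ## § 2 The relevant (counted) collisions of the window and their enumeration -/

open scoped Classical in
/-- Particle `i` is a **counted participant** of the collision happening at time `t` along the orbit
of `z`: it participates and `t ≤ stopTime` (the collision is among its first `K + 1`).
Boolean-valued (decided classically). -/
def counted {σ : ℝ} {N : ℕ} (Φ : Flow σ N) (K : ℕ) (h t : ℝ) (i : Fin (N + 1)) (z : Phase N) : Bool :=
  decide (Participates (Torus.geometry (Fin 3)) (hsDiameter σ N) (Φ.flow t z) i ∧ t ≤ stopTime Φ K h i z)

/-- The **relevant collision times** of the window: collision times in `(0, h]` with at least one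
counted participant. On a good orbit there are at most `(N+1)(K+1)` of them. -/
def relTimes {σ : ℝ} {N : ℕ} (Φ : Flow σ N) (K : ℕ) (h : ℝ) (z : Phase N) : Set ℝ :=
  {t | t ∈ collisionTimes (Torus.geometry (Fin 3)) (hsDiameter σ N) (fun s => Φ.flow s z) ∧
    t ∈ Set.Ioc 0 h ∧ ∃ i, counted Φ K h t i z = true}

/-- The number of relevant collisions of the window (finite on good orbits; junk `0` otherwise). -/
def relCount {σ : ℝ} {N : ℕ} (Φ : Flow σ N) (K : ℕ) (h : ℝ) (z : Phase N) : ℕ :=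
  (relTimes Φ K h z).ncard

/-- The time of the `n`-th relevant collision (`n = 0` the first), enumerated in increasing order
from time `0` (`Literature.Analysis.FluidPDE.nthTimeAfter`; junk beyond `relCount`). -/
def relTime {σ : ℝ} {N : ℕ} (Φ : Flow σ N) (K : ℕ) (h : ℝ) (z : Phase N) (n : ℕ) : ℝ :=
  nthTimeAfter (relTimes Φ K h z) 0 n

/-- The deterministic martingale horizon `m = (N+1)(K+1) ≥ relCount` (on good orbits). -/
def horizon (N K : ℕ) : ℕ := (N + 1) * (K + 1)

/-! ## § 3 Discrete marks, the binned collision payload and the causal coarse record -/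

/-- Binning of a real at resolution `r`: the integer label `⌊x / r⌋`. -/
def bin (r x : ℝ) : ℤ := ⌊x / r⌋

/-- The binned value `r ⌊x / r⌋` (within `r` of `x`). -/
def binVal (r x : ℝ) : ℝ := r * (bin r x : ℝ)

/-- Binning of a velocity, coordinatewise. -/
def binVec (r : ℝ) (w : V3) : Fin 3 → ℤ := fun k => bin r (w k)

/-- Symmetric clipping at level `R`. -/
def clip (R x : ℝ) : ℝ := max (-R) (min R x)

/-- The pre-collisional velocity of particle `i` in the configuration `z'` reached at a collision
(read off through the elastic involution, `HardSphereCollisionRecord.ofConfig`; junk if `i` does not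
participate). -/
def preVelOf {σ : ℝ} {N : ℕ} (z' : Phase N) (i : Fin (N + 1)) : V3 :=
  (HardSphereCollisionRecord.ofConfig (Torus.geometry (Fin 3)) (hsDiameter σ N) z' 0 i
    (partner (Torus.geometry (Fin 3)) (hsDiameter σ N) z' i)).preVel.1

/-- The **discrete mark of one particle** at a collision instant: cell of its position (mesh `δx`),
binned post- and pre-collisional scaled velocities (mesh `δv`), binned value of the test function
`φ'` at its position (mesh `δφ`), binned values of the Chapman–Enskog profile `ψ₀` at its post- and
pre-collisional scaled velocities (mesh `δ₀`), and the two flags (participates, counted). -/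
abbrev ParticleMark : Type :=
  (Fin 3 → ℤ) × (Fin 3 → ℤ) × (Fin 3 → ℤ) × ℤ × ℤ × ℤ × Bool × Bool

/-- The discrete mark of a collision instant: time slot (mesh `δt`) and every particle's mark. -/
abbrev Mark (N : ℕ) : Type := ℤ × (Fin (N + 1) → ParticleMark)

open scoped Classical in
/-- The mark of particle `i` at time `t` along the orbit of `z`. -/
def particleMarkAt (θ : ℝ) (u₀ : V3) (φ' : T3 → ℝ) (ψ₀ : V3 → ℝ) (K : ℕ) (h δx δv δφ δ₀ : ℝ)
    {σ : ℝ} {N : ℕ} (Φ : Flow σ N) (t : ℝ) (z : Phase N) (i : Fin (N + 1)) : ParticleMark :=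
  let z' := Φ.flow t z
  (Torus.coarseCell δx (z' i).1,
   binVec δv (sv θ u₀ (z' i).2),
   binVec δv (sv θ u₀ (preVelOf (σ := σ) z' i)),
   bin δφ (φ' (z' i).1),
   bin δ₀ (ψ₀ (sv θ u₀ (z' i).2)),
   bin δ₀ (ψ₀ (sv θ u₀ (preVelOf (σ := σ) z' i))),
   decide (Participates (Torus.geometry (Fin 3)) (hsDiameter σ N) z' i),
   counted Φ K h t i z)

/-- The mark of the collision instant `t` along the orbit of `z`. -/
def markAt (θ : ℝ) (u₀ : V3) (φ' : T3 → ℝ) (ψ₀ : V3 → ℝ) (K : ℕ) (h δt δx δv δφ δ₀ : ℝ)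
    {σ : ℝ} {N : ℕ} (Φ : Flow σ N) (t : ℝ) (z : Phase N) : Mark N :=
  (bin δt t, fun i => particleMarkAt θ u₀ φ' ψ₀ K h δx δv δφ δ₀ Φ t z i)

/-- The **binned, clamped payload of one particle's jump** at the collision instant `t`:
`c ℓ · φ̃'(xᵢ) · (ψ̃₀(wᵢ⁺) - ψ̃₀(wᵢ⁻))` if `i` is a counted participant, else `0` (binned values, so
it is a function of the particle's discrete mark). -/
def payloadAt (θ : ℝ) (u₀ : V3) (φ' : T3 → ℝ) (ψ₀ : V3 → ℝ) (c : ℝ) (K : ℕ) (h δφ δ₀ : ℝ)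
    {σ : ℝ} {N : ℕ} (Φ : Flow σ N) (t : ℝ) (z : Phase N) (i : Fin (N + 1)) : ℝ :=
  if counted Φ K h t i z = true then
    c * ell N * binVal δφ (φ' (Φ.flow t z i).1) *
      (binVal δ₀ (ψ₀ (sv θ u₀ (Φ.flow t z i).2)) -
        binVal δ₀ (ψ₀ (sv θ u₀ (preVelOf (σ := σ) (Φ.flow t z) i))))
  else 0

/-- The payload cap `R = 8 c ℓ (b + δ₀)` (`b` a bound on `|ψ₀|`; on good orbits, where collisions
are binary and `|φ̃'| ≤ 2`, clipping at `R` is inactive). -/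
def payloadCap (c b δ₀ : ℝ) (N : ℕ) : ℝ := 8 * c * ell N * (b + δ₀)

open scoped Classical in
/-- The **binned payload `Ỹₙ` of the `n`-th relevant collision** (sum over counted participants,
clipped at the cap; `0` beyond `relCount` and off the good set). -/
def payloadY (θ : ℝ) (u₀ : V3) (φ' : T3 → ℝ) (ψ₀ : V3 → ℝ) (c b : ℝ) (K : ℕ) (τ δφ δ₀ : ℝ)
    {σ : ℝ} {N : ℕ} (Φ : Flow σ N) (n : ℕ) (z : Phase N) : ℝ :=
  if z ∈ Φ.good ∧ n < relCount Φ K (window τ N) z then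
    clip (payloadCap c b δ₀ N)
      (∑ i, payloadAt θ u₀ φ' ψ₀ c K (window τ N) δφ δ₀ Φ (relTime Φ K (window τ N) z n) z i)
  else 0

/-- The **partial-sum process `X̃ₙ = ∑_{m<n} Ỹₘ`** of binned collision payloads (`X̃₀ = 0`). -/
def procX (θ : ℝ) (u₀ : V3) (φ' : T3 → ℝ) (ψ₀ : V3 → ℝ) (c b : ℝ) (K : ℕ) (τ δφ δ₀ : ℝ)
    {σ : ℝ} {N : ℕ} (Φ : Flow σ N) (n : ℕ) (z : Phase N) : ℝ :=
  ∑ m ∈ Finset.range n, payloadY θ u₀ φ' ψ₀ c b K τ δφ δ₀ Φ m z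

open scoped Classical in
/-- The **causal coarse record** up to (excluding) the `n`-th relevant collision: the marks of the
relevant collisions `0, …, n-1` (masked beyond `relCount` and off the good set; `Ỹₘ`, `m < n`, is a
fixed function of it, so `X̃` is adapted to any filtration between `σ(X̃)` and `causalSigma`). -/
def record (θ : ℝ) (u₀ : V3) (φ' : T3 → ℝ) (ψ₀ : V3 → ℝ) (K : ℕ) (τ δt δx δv δφ δ₀ : ℝ)
    {σ : ℝ} {N : ℕ} (Φ : Flow σ N) (n : ℕ) (z : Phase N) : ℕ → Bool × Mark N :=
  fun m =>
    if z ∈ Φ.good ∧ m < n ∧ m < relCount Φ K (window τ N) z then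
      (true, markAt θ u₀ φ' ψ₀ K (window τ N) δt δx δv δφ δ₀ Φ (relTime Φ K (window τ N) z m) z)
    else (false, default)

/-- The **σ-algebra of the causal coarse record** before the `n`-th relevant collision
(`MeasurableSpace.comap` of `record`; generated by countably-valued marks, hence atomic: no filtration
below it can pin the microstate). -/
@[reducible] def causalSigma (θ : ℝ) (u₀ : V3) (φ' : T3 → ℝ) (ψ₀ : V3 → ℝ) (K : ℕ) (τ δt δx δv δφ δ₀ : ℝ)
    {σ : ℝ} {N : ℕ} (Φ : Flow σ N) (n : ℕ) : MeasurableSpace (Phase N) :=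
  MeasurableSpace.comap (record θ u₀ φ' ψ₀ K τ δt δx δv δφ δ₀ Φ n) inferInstance

/-! ## § 4 Doob decomposition along a coarse collision filtration: innovations and compensator defect -/

/-- The **innovation martingale** `M = martingalePart X̃` at the horizon, for a filtration `ℱ`. -/
def innov (a θ : ℝ) (u₀ : V3) (φ' : T3 → ℝ) (ψ₀ : V3 → ℝ) (c b : ℝ) (K : ℕ) (τ δφ δ₀ : ℝ)
    {σ : ℝ} {N : ℕ} (Φ : Flow σ N) (ℱ : Filtration ℕ (inferInstance : MeasurableSpace (Phase N)))
    (z : Phase N) : ℝ :=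
  martingalePart (procX θ u₀ φ' ψ₀ c b K τ δφ δ₀ Φ) ℱ (gibbs σ a θ u₀ N Φ) (horizon N K) z

/-- The **compensator** `C = predictablePart X̃` at the horizon, for a filtration `ℱ`. -/
def comp (a θ : ℝ) (u₀ : V3) (φ' : T3 → ℝ) (ψ₀ : V3 → ℝ) (c b : ℝ) (K : ℕ) (τ δφ δ₀ : ℝ)
    {σ : ℝ} {N : ℕ} (Φ : Flow σ N) (ℱ : Filtration ℕ (inferInstance : MeasurableSpace (Phase N)))
    (z : Phase N) : ℝ :=
  predictablePart (procX θ u₀ φ' ψ₀ c b K τ δφ δ₀ Φ) ℱ (gibbs σ a θ u₀ N Φ) (horizon N K) z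

/-- The **predictable compensator defect** `R = C - h·B`: the compensator of the clamped binned
collision payloads minus the clamped window integral of `F' = ∑ φ'(xᵢ) g(wᵢ)`, `g = L ψ₀`. -/
def defect (a θ : ℝ) (u₀ : V3) (φ' : T3 → ℝ) (ψ₀ g : V3 → ℝ) (c b : ℝ) (K : ℕ) (τ δφ δ₀ : ℝ)
    {σ : ℝ} {N : ℕ} (Φ : Flow σ N) (ℱ : Filtration ℕ (inferInstance : MeasurableSpace (Phase N)))
    (z : Phase N) : ℝ :=
  comp a θ u₀ φ' ψ₀ c b K τ δφ δ₀ Φ ℱ z - window τ N * obsB θ u₀ φ' g τ K Φ z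

/-! ## § 5 Basic API of the objects and the registered bookkeeping stub S0 -/

/-- Clipping bounds: `|clip R x| ≤ R` for `R ≥ 0`. -/
theorem abs_clip_le {R : ℝ} (hR : 0 ≤ R) (x : ℝ) : |clip R x| ≤ R := by
  unfold clip
  rw [abs_le]
  exact ⟨le_max_left _ _, max_le (by linarith) (min_le_left _ _)⟩

/-- `ℓ_N = (N+1)^{-1/3} > 0`. -/
theorem ell_pos (N : ℕ) : 0 < ell N := Real.rpow_pos_of_pos (by positivity) _

/-- The window is `τ ℓ_N`. -/
theorem window_eq (τ : ℝ) (N : ℕ) : window τ N = τ * ell N := rfl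

/-- The window is positive for `τ > 0`. -/
theorem window_pos {τ : ℝ} (hτ : 0 < τ) (N : ℕ) : 0 < window τ N := mul_pos hτ (ell_pos N)

/-- The payload cap `8cℓ(b+δ₀)` is non-negative for `c, b, δ₀ ≥ 0`. -/
theorem payloadCap_nonneg {c b δ₀ : ℝ} (hc : 0 ≤ c) (hb : 0 ≤ b) (hδ₀ : 0 ≤ δ₀) (N : ℕ) :
    0 ≤ payloadCap c b δ₀ N := by
  unfold payloadCap
  have := (ell_pos N).le
  positivity

/-- Every binned payload `Ỹₙ` is bounded by the cap (it is clipped there, or `0`). -/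
theorem abs_payloadY_le (θ : ℝ) (u₀ : V3) (φ' : T3 → ℝ) (ψ₀ : V3 → ℝ) {c b : ℝ} (K : ℕ) (τ δφ : ℝ)
    {δ₀ : ℝ} (hc : 0 ≤ c) (hb : 0 ≤ b) (hδ₀ : 0 ≤ δ₀) {σ : ℝ} {N : ℕ} (Φ : Flow σ N) (n : ℕ)
    (z : Phase N) : |payloadY θ u₀ φ' ψ₀ c b K τ δφ δ₀ Φ n z| ≤ payloadCap c b δ₀ N := by
  unfold payloadY
  split_ifs
  · exact abs_clip_le (payloadCap_nonneg hc hb hδ₀ N) _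
  · simpa using payloadCap_nonneg hc hb hδ₀ N

/-- `X̃₀ = 0` (empty sum). -/
theorem procX_zero (θ : ℝ) (u₀ : V3) (φ' : T3 → ℝ) (ψ₀ : V3 → ℝ) (c b : ℝ) (K : ℕ) (τ δφ δ₀ : ℝ)
    {σ : ℝ} {N : ℕ} (Φ : Flow σ N) (z : Phase N) : procX θ u₀ φ' ψ₀ c b K τ δφ δ₀ Φ 0 z = 0 := by
  simp [procX]

/-- `X̃ₙ₊₁ - X̃ₙ = Ỹₙ`. -/
theorem procX_succ_sub (θ : ℝ) (u₀ : V3) (φ' : T3 → ℝ) (ψ₀ : V3 → ℝ) (c b : ℝ) (K : ℕ)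
    (τ δφ δ₀ : ℝ) {σ : ℝ} {N : ℕ} (Φ : Flow σ N) (n : ℕ) (z : Phase N) :
    procX θ u₀ φ' ψ₀ c b K τ δφ δ₀ Φ (n + 1) z - procX θ u₀ φ' ψ₀ c b K τ δφ δ₀ Φ n z =
      payloadY θ u₀ φ' ψ₀ c b K τ δφ δ₀ Φ n z := by
  simp [procX, Finset.sum_range_succ]

/-- **The exact pathwise identity** `B = h⁻¹X̃ₘ - h⁻¹M - h⁻¹R` for every filtration `ℱ`
(Mathlib's Doob decomposition `martingalePart_add_predictablePart` and the definition of the defect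
`R = C - hB`). -/
theorem obsB_eq (a θ : ℝ) (u₀ : V3) (φ' : T3 → ℝ) (ψ₀ g : V3 → ℝ) (c b : ℝ) (K : ℕ) (τ δφ δ₀ : ℝ)
    {σ : ℝ} {N : ℕ} (Φ : Flow σ N) (ℱ : Filtration ℕ (inferInstance : MeasurableSpace (Phase N)))
    (hτ : 0 < τ) (z : Phase N) :
    obsB θ u₀ φ' g τ K Φ z =
      (window τ N)⁻¹ * procX θ u₀ φ' ψ₀ c b K τ δφ δ₀ Φ (horizon N K) z -
      (window τ N)⁻¹ * innov a θ u₀ φ' ψ₀ c b K τ δφ δ₀ Φ ℱ z -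
      (window τ N)⁻¹ * defect a θ u₀ φ' ψ₀ g c b K τ δφ δ₀ Φ ℱ z := by
  have hh : window τ N ≠ 0 := (window_pos hτ N).ne'
  have hDoob := congrFun (congrFun (martingalePart_add_predictablePart ℱ (gibbs σ a θ u₀ N Φ)
    (procX θ u₀ φ' ψ₀ c b K τ δφ δ₀ Φ)) (horizon N K)) z
  simp only [Pi.add_apply] at hDoob
  unfold defect comp innov
  rw [← hDoob]
  field_simp
  ring

/-- The truncation map on records: keep the entries of index `< n`, mask the rest. -/
def truncRecord (N n : ℕ) (f : ℕ → Bool × Mark N) : ℕ → Bool × Mark N :=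
  fun m => if m < n then f m else (false, default)

/-- The truncation map is measurable (coordinatewise it is a coordinate projection or a constant). -/
theorem measurable_truncRecord (N n : ℕ) : Measurable (truncRecord N n) := by
  refine measurable_pi_lambda _ fun m => ?_
  by_cases hm : m < n
  · simp only [truncRecord, hm, if_true]
    exact measurable_pi_apply m
  · simp only [truncRecord, hm, if_false]
    exact measurable_const

/-- The record before collision `n` is the truncation of the record before collision `n + 1`. -/
theorem record_eq_truncRecord_comp (θ : ℝ) (u₀ : V3) (φ' : T3 → ℝ) (ψ₀ : V3 → ℝ) (K : ℕ)
    (τ δt δx δv δφ δ₀ : ℝ) {σ : ℝ} {N : ℕ} (Φ : Flow σ N) (n : ℕ) :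
    record θ u₀ φ' ψ₀ K τ δt δx δv δφ δ₀ Φ n =
      truncRecord N n ∘ record θ u₀ φ' ψ₀ K τ δt δx δv δφ δ₀ Φ (n + 1) := by
  classical
  funext z m
  simp only [Function.comp_apply, truncRecord, record]
  by_cases hm : m < n
  · rw [if_pos hm]
    exact if_congr ⟨fun h => ⟨h.1, Nat.lt_succ_of_lt hm, h.2.2⟩, fun h => ⟨h.1, hm, h.2.2⟩⟩ rfl rfl
  · rw [if_neg hm, if_neg fun h => hm h.2.1]

/-- **The causal coarse record σ-algebras increase with the collision index.** -/
theorem causalSigma_le_succ (θ : ℝ) (u₀ : V3) (φ' : T3 → ℝ) (ψ₀ : V3 → ℝ) (K : ℕ)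
    (τ δt δx δv δφ δ₀ : ℝ) {σ : ℝ} {N : ℕ} (Φ : Flow σ N) (n : ℕ) :
    causalSigma θ u₀ φ' ψ₀ K τ δt δx δv δφ δ₀ Φ n ≤
      causalSigma θ u₀ φ' ψ₀ K τ δt δx δv δφ δ₀ Φ (n + 1) := by
  unfold causalSigma
  rw [record_eq_truncRecord_comp θ u₀ φ' ψ₀ K τ δt δx δv δφ δ₀ Φ n, ← MeasurableSpace.comap_comp]
  exact MeasurableSpace.comap_mono ((measurable_truncRecord N n).comap_le)

/-- **Registered stub S0 `stub_skeletonBookkeeping`** of the line `dynkin-azuma-collision-innovations`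
(crux stmt-AtomisticToContinuum-10967): (i) increments/cap of the payload process, (ii) the exact
Doob identity `B = h⁻¹X̃ₘ - h⁻¹M - h⁻¹R`, (iii) monotonicity of the causal record σ-algebras. [folklore] -/
theorem stub_skeletonBookkeeping :
    (∀ (θ : ℝ) (u₀ : V3) (φ' : T3 → ℝ) (ψ₀ : V3 → ℝ) (c b : ℝ) (K : ℕ) (τ δφ δ₀ : ℝ),
      0 ≤ c → 0 ≤ b → 0 ≤ δ₀ → ∀ (σ : ℝ) (N : ℕ) (Φ : Flow σ N),
        0 ≤ payloadCap c b δ₀ N ∧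
        (∀ z : Phase N, procX θ u₀ φ' ψ₀ c b K τ δφ δ₀ Φ 0 z = 0) ∧
        ∀ (n : ℕ) (z : Phase N),
          |procX θ u₀ φ' ψ₀ c b K τ δφ δ₀ Φ (n + 1) z - procX θ u₀ φ' ψ₀ c b K τ δφ δ₀ Φ n z| ≤
            payloadCap c b δ₀ N) ∧
    (∀ (a θ : ℝ) (u₀ : V3) (φ' : T3 → ℝ) (ψ₀ g : V3 → ℝ) (c b : ℝ) (K : ℕ) (τ δφ δ₀ : ℝ)
      (σ : ℝ) (N : ℕ) (Φ : Flow σ N) (ℱ : Filtration ℕ (inferInstance : MeasurableSpace (Phase N))),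
      0 < τ → ∀ z : Phase N,
        obsB θ u₀ φ' g τ K Φ z =
          (window τ N)⁻¹ * procX θ u₀ φ' ψ₀ c b K τ δφ δ₀ Φ (horizon N K) z -
          (window τ N)⁻¹ * innov a θ u₀ φ' ψ₀ c b K τ δφ δ₀ Φ ℱ z -
          (window τ N)⁻¹ * defect a θ u₀ φ' ψ₀ g c b K τ δφ δ₀ Φ ℱ z) ∧
    (∀ (θ : ℝ) (u₀ : V3) (φ' : T3 → ℝ) (ψ₀ : V3 → ℝ) (K : ℕ) (τ δt δx δv δφ δ₀ : ℝ)
      (σ : ℝ) (N : ℕ) (Φ : Flow σ N) (n : ℕ),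
      causalSigma θ u₀ φ' ψ₀ K τ δt δx δv δφ δ₀ Φ n ≤
        causalSigma θ u₀ φ' ψ₀ K τ δt δx δv δφ δ₀ Φ (n + 1)) := by
  refine ⟨fun θ u₀ φ' ψ₀ c b K τ δφ δ₀ hc hb hδ₀ σ N Φ => ⟨payloadCap_nonneg hc hb hδ₀ N,
      fun z => procX_zero θ u₀ φ' ψ₀ c b K τ δφ δ₀ Φ z, fun n z => ?_⟩,
    fun a θ u₀ φ' ψ₀ g c b K τ δφ δ₀ σ N Φ ℱ hτ z =>
      obsB_eq a θ u₀ φ' ψ₀ g c b K τ δφ δ₀ Φ ℱ hτ z,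
    fun θ u₀ φ' ψ₀ K τ δt δx δv δφ δ₀ σ N Φ n =>
      causalSigma_le_succ θ u₀ φ' ψ₀ K τ δt δx δv δφ δ₀ Φ n⟩
  rw [procX_succ_sub]
  exact abs_payloadY_le θ u₀ φ' ψ₀ K τ δφ hc hb hδ₀ Φ n z

end Summit.AtomisticToContinuum.HydrodynamicLimit.Theorems.DynkinAzuma

end
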